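import Summits.CriticalPhenomena.SAWScalingLimit.Theorems.SAWDefectDecoherenceObservableToSLERCarvedReductionSqueezeTwoPieceFamily
import Literature.Probability.RandomPlanarGeometry.PlanarDomainsTopology
import Literature.Probability.RandomPlanarGeometry.ConformalRestrictionProofs
import Literature.Topology.PlaneTopology.JordanCurveProofs
import HarnessLib

/-!
# Two-piece flat Dobrushin domains: the family block of ARL″ for a hull-subdomain pair
# (piece (G4′e) of stub 5a4′ `stub_carvedReduction_squeeze`)

Piece of stub 5a4′ `stub_carvedReduction_squeeze` (`TwoPieceAdmRestrictionLimit → MovingCarvingSqueeze`)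
of the line `bridge-gate-renewal` (r9) of the crux `SAWDefectDecoherence.ObservableToSLER`
(stmt-CriticalPhenomena-14005; twin T2b′/T2b″ of stmt-CriticalPhenomena-10472), item (G4′),
packaging for the consumers.  `stub_carvedReduction_twoPieceFamily` (piece (G4′d)) is stated for
bare sets; here it is specialised to what the squeeze feeds to ARL″: a two-piece flat Dobrushin
domain `E` and a hull subdomain `M` of `E`, both flat (exact upper half-discs) in the `ρ`-balls
about the marked points `E.pt 0`, `E.pt 1` (`dist ≥ 2ρ`), prescribed threshold rows `m i δ` and
gate up-faces `(g i δ, 0)`.  The exterior hypotheses come from the Jordan curve theorem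
(`JordanDomain.exterior_of_JCT`, `JordanCurveTheorem_holds`).

* `stub_carvedReduction_twoPieceFamilyDobrushin` — families `Λ ⊇ Λ'` and the vertical gate
  mid-edges `a δ`, `b δ` satisfying VERBATIM the admissibility block, the two compact exhaustions
  and the two endpoint limits of `TwoPieceAdmRestrictionLimit` for the pair `(E, M)` with radius
  `ρ/16` and thresholds `m₀ := m 0`, `m₁ = m₁' := m 1`, together with the flatness of `E` at
  radius `ρ/16` (its first hypothesis); the `Λ'`-half is at the same time the family block of
  `MovingCarvingSqueeze` for `M` (`ρ' := ρ/16`).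
-/

noncomputable section

open scoped Topology
open Filter Set Metric
open Literature.Probability.LatticeModels (HexVertex hexGraph hexCenter Site)
open Literature.Probability.RandomPlanarGeometry
open Literature.Probability.RandomPlanarGeometry.SAW
open Literature.Topology.PlaneTopology (JordanCurveTheorem_holds)

namespace Summit.CriticalPhenomena.SAWScalingLimit.Theorems.ObservableToSLER.Squeeze

/-- **Registered sub-goal `stub_carvedReduction_twoPieceFamilyDobrushin`** (crux item
stmt-CriticalPhenomena-14005, stub 5a4′ `stub_carvedReduction_squeeze`, piece (G4′e) THE FAMILY BLOCK
OF ARL″ FOR A TWO-PIECE FLAT HULL-SUBDOMAIN PAIR): see the module docstring. -/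
theorem stub_carvedReduction_twoPieceFamilyDobrushin :
    ∀ (E M : DobrushinDomain) (ρ : ℝ) (m : Fin 2 → ℝ → ℤ) (g : Fin 2 → ℝ → Site 2),
      E.IsHullSubdomain M → 0 < ρ → 2 * ρ ≤ dist (E.pt 0) (E.pt 1) →
      (∀ i, E.carrier ∩ ball (E.pt i) ρ = {z : ℂ | (E.pt i).im < z.im} ∩ ball (E.pt i) ρ) →
      (∀ i, M.carrier ∩ ball (E.pt i) ρ = {z : ℂ | (E.pt i).im < z.im} ∩ ball (E.pt i) ρ) →
      (∀ i, ∀ᶠ δ : ℝ in 𝓝[>] 0, (E.pt i).im < ((m i δ : ℝ) + 1 / 3) * (δ * (Real.sqrt 3 / 2))) →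
      (∀ i, Tendsto (fun δ : ℝ => ((m i δ : ℝ) + 1 / 3) * (δ * (Real.sqrt 3 / 2))) (𝓝[>] 0)
        (𝓝 (E.pt i).im)) →
      (∀ i, ∀ᶠ δ : ℝ in 𝓝[>] 0, g i δ 1 = m i δ) →
      (∀ i, Tendsto (fun δ : ℝ => (δ : ℂ) * hexCenter ((g i δ, 0) : HexVertex)) (𝓝[>] 0) (𝓝 (E.pt i))) →
      ∃ (Λ Λ' : ℝ → Finset HexVertex) (a b : ℝ → Sym2 HexVertex),
        (∀ δ, a δ = s(((g 0 δ, 0) : HexVertex), (g 0 δ - Pi.single 1 1, 1))) ∧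
        (∀ δ, b δ = s(((g 1 δ, 0) : HexVertex), (g 1 δ - Pi.single 1 1, 1))) ∧
        (0 < ρ / 16 ∧ ∀ i : Fin 2, E.carrier ∩ ball (E.pt i) (ρ / 16) =
          {z : ℂ | (E.pt i).im < z.im} ∩ ball (E.pt i) (ρ / 16)) ∧
        (0 < ρ / 16 ∧ ∀ i : Fin 2, M.carrier ∩ ball (M.pt i) (ρ / 16) =
          {z : ℂ | (M.pt i).im < z.im} ∩ ball (M.pt i) (ρ / 16)) ∧
        (∀ᶠ δ : ℝ in 𝓝[>] 0,
          Λ' δ ⊆ Λ δ ∧ hexDomainSimplyConnected (Λ δ) ∧ hexDomainSimplyConnected (Λ' δ) ∧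
          (hexGraph.induce (↑(Λ δ) : Set HexVertex)).Preconnected ∧
          (hexGraph.induce (↑(Λ' δ) : Set HexVertex)).Preconnected ∧
          a δ ∈ hexDomainBoundary (Λ δ) ∧ b δ ∈ hexDomainBoundary (Λ δ) ∧
          a δ ∈ hexDomainBoundary (Λ' δ) ∧ b δ ∈ hexDomainBoundary (Λ' δ) ∧
          Nonempty (HexMidEdgeSAW (Λ' δ) (a δ) (b δ)) ∧
          (∀ v ∈ Λ δ, (δ : ℂ) * hexCenter v ∈ E.carrier) ∧
          (∀ v ∈ Λ' δ, (δ : ℂ) * hexCenter v ∈ M.carrier) ∧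
          (∀ v : HexVertex, (δ : ℂ) * hexCenter v ∈ ball (E.pt 0) (ρ / 16) →
            ((v ∈ Λ δ ↔ m 0 δ ≤ v.1 1) ∧ (v ∈ Λ' δ ↔ m 0 δ ≤ v.1 1))) ∧
          (∀ v : HexVertex, (δ : ℂ) * hexCenter v ∈ ball (E.pt 1) (ρ / 16) →
            ((v ∈ Λ δ ↔ m 1 δ ≤ v.1 1) ∧ (v ∈ Λ' δ ↔ m 1 δ ≤ v.1 1)))) ∧
        (∀ᶠ δ : ℝ in 𝓝[>] 0, Nonempty (HexMidEdgeSAW (Λ δ) (a δ) (b δ))) ∧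
        (∀ K : Set ℂ, IsCompact K → K ⊆ E.carrier →
          ∀ᶠ δ : ℝ in 𝓝[>] 0, ∀ v : HexVertex, (δ : ℂ) * hexCenter v ∈ K → v ∈ Λ δ) ∧
        (∀ K : Set ℂ, IsCompact K → K ⊆ M.carrier →
          ∀ᶠ δ : ℝ in 𝓝[>] 0, ∀ v : HexVertex, (δ : ℂ) * hexCenter v ∈ K → v ∈ Λ' δ) ∧
        Tendsto (fun δ : ℝ => (δ : ℂ) * hexMidpoint (a δ)) (𝓝[>] 0) (𝓝 (E.pt 0)) ∧
        Tendsto (fun δ : ℝ => (δ : ℂ) * hexMidpoint (b δ)) (𝓝[>] 0) (𝓝 (E.pt 1)) ∧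
        Tendsto (fun δ : ℝ => (δ : ℂ) * hexMidpoint (a δ)) (𝓝[>] 0) (𝓝 (M.pt 0)) ∧
        Tendsto (fun δ : ℝ => (δ : ℂ) * hexMidpoint (b δ)) (𝓝[>] 0) (𝓝 (M.pt 1)) := by
  intro E M ρ m g hM hρ hsep hflE hflM hmlo hmhi hg hglim
  -- exterior data from the Jordan curve theorem
  obtain ⟨hEc, hEfr, -⟩ := E.toJordanDomain.exterior_of_JCT JordanCurveTheorem_holds
  obtain ⟨hMc, hMfr, -⟩ := M.toJordanDomain.exterior_of_JCT JordanCurveTheorem_holds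
  have hpt : ∀ i, M.pt i = E.pt i := by
    intro i; fin_cases i
    · exact hM.pt_zero_eq
    · exact hM.pt_one_eq
  obtain ⟨Λ, Λ', hmain, hexE, hexM, hlim⟩ := stub_carvedReduction_twoPieceFamily E.carrier M.carrier ρ
    E.pt m g E.isOpen E.isConnected E.isBounded hEc hEfr M.isOpen M.isConnected hMc hMfr
    hM.carrier_subset hρ hsep hflE hflM hmlo hmhi hg hglim
  -- flatness at the smaller radius
  have hflat : ∀ {Ω : Set ℂ} {q : ℂ}, Ω ∩ ball q ρ = {z : ℂ | q.im < z.im} ∩ ball q ρ →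
      Ω ∩ ball q (ρ / 16) = {z : ℂ | q.im < z.im} ∩ ball q (ρ / 16) := by
    intro Ω q h
    have hsub : ball q (ρ / 16) ⊆ ball q ρ := ball_subset_ball (by linarith)
    ext z
    constructor
    · rintro ⟨hzΩ, hzb⟩
      have : z ∈ Ω ∩ ball q ρ := ⟨hzΩ, hsub hzb⟩
      rw [h] at this
      exact ⟨this.1, hzb⟩
    · rintro ⟨hzim, hzb⟩
      have : z ∈ {z : ℂ | q.im < z.im} ∩ ball q ρ := ⟨hzim, hsub hzb⟩
      rw [← h] at this
      exact ⟨this.1, hzb⟩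
  refine ⟨Λ, Λ', fun δ => s(((g 0 δ, 0) : HexVertex), (g 0 δ - Pi.single 1 1, 1)),
    fun δ => s(((g 1 δ, 0) : HexVertex), (g 1 δ - Pi.single 1 1, 1)), fun δ => rfl, fun δ => rfl,
    ⟨by positivity, fun i => hflat (hflE i)⟩, ⟨by positivity, fun i => ?_⟩, ?_, ?_, hexE, hexM,
    hlim 0, hlim 1, ?_, ?_⟩
  · rw [hpt i]; exact hflat (hflM i)
  · filter_upwards [hmain] with δ h
    obtain ⟨hnest, hsc, hsc', hconn, hconn', hΛE, hΛM, hrows, hbd, hsaw, hsaw'⟩ := h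
    exact ⟨hnest, hsc, hsc', hconn, hconn', (hbd 0).1, (hbd 1).1, (hbd 0).2, (hbd 1).2, hsaw',
      hΛE, hΛM, hrows 0, hrows 1⟩
  · filter_upwards [hmain] with δ h
    exact h.2.2.2.2.2.2.2.2.2.1
  · rw [hpt 0]; exact hlim 0
  · rw [hpt 1]; exact hlim 1

end Summit.CriticalPhenomena.SAWScalingLimit.Theorems.ObservableToSLER.Squeeze

end
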